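import Mathlib
import Literature.Combinatorics.Additive.TripleProductProperty
import Summits.MatrixMultiplication.MatrixMultiplication.Theses.SnSubsetDichotomy

/-!
# Sketch — crux-ideate round 2, ideator 6 (crux stmt-MatrixMultiplication-10882, `ThresholdSubsetTriples`)

§1  The EQUIVARIANT COMPOSITION LEMMA (`tpp_of_normalised_relative`, proved): relative designs
    normalised by a subgroup `Z` and "TPP modulo `Z`" compose with ANY TPP triple inside `Z`.
§2  The recursion form for `S_n` (statement only): `RelativeThreshold → ThresholdSubsetTriples`.
§3  Generalised Wedderburn sieve (statement only, for the negative side): Plancherel-fat members.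
-/

open scoped Pointwise

namespace Summit.MatrixMultiplication.MatrixMultiplication.Cruxes.ThresholdSubsetTriples.Ideator6

open Literature.Combinatorics.Additive

variable {G : Type*} [Group G] [DecidableEq G]

/-- `Z` normalises the finite set `X` under conjugation: `z x z⁻¹ ∈ X` for `z ∈ Z`, `x ∈ X`. -/
def Normalises (Z : Subgroup G) (X : Finset G) : Prop :=
  ∀ z ∈ Z, ∀ x ∈ X, z * x * z⁻¹ ∈ X

/-- TPP MODULO `Z` ("`Z`-TPP"): a product of three quotients lands in `Z` only trivially. For `Z = ⊥`
this is literally `TripleProductProperty`. -/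
def ZTPP (Z : Subgroup G) (S T U : Finset G) : Prop :=
  ∀ s ∈ S, ∀ s' ∈ S, ∀ t ∈ T, ∀ t' ∈ T, ∀ u ∈ U, ∀ u' ∈ U,
    s * s'⁻¹ * (t * t'⁻¹) * (u * u'⁻¹) ∈ Z → s = s' ∧ t = t' ∧ u = u'

omit [DecidableEq G] in
theorem Normalises.conj_mem {Z : Subgroup G} {X : Finset G} (h : Normalises Z X) {z : G}
    (hz : z ∈ Z) {x : G} (hx : x ∈ X) : z⁻¹ * x * z ∈ X := by
  simpa using h z⁻¹ (Z.inv_mem hz) x hx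

omit [DecidableEq G] in
theorem ztpp_bot_iff (S T U : Finset G) : ZTPP ⊥ S T U ↔ TripleProductProperty S T U := by
  simp only [ZTPP, TripleProductProperty, Subgroup.mem_bot]

/-- **Equivariant composition lemma.** If `Z` normalises `S₀, T₀, U₀`, the triple is TPP modulo `Z`,
and `(A, B, C)` is a TPP triple INSIDE `Z`, then `(S₀A, T₀B, U₀C)` is a TPP triple of `G`.
Proof: push the `Z`-parts `α = a a'⁻¹, β = b b'⁻¹, γ = c c'⁻¹` to the left, conjugating set
elements by elements of `Z` on the way (they stay in their sets); the remaining product of three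
genuine quotients lies in `Z`, hence is trivial (`Z`-TPP); then `αβγ = 1`, hence trivial (TPP in `Z`). -/
theorem tpp_of_normalised_relative (Z : Subgroup G) (S₀ T₀ U₀ A B C : Finset G)
    (hS : Normalises Z S₀) (hT : Normalises Z T₀) (hU : Normalises Z U₀)
    (hZ : ZTPP Z S₀ T₀ U₀)
    (hA : ∀ a ∈ A, a ∈ Z) (hB : ∀ b ∈ B, b ∈ Z) (hC : ∀ c ∈ C, c ∈ Z)
    (hABC : TripleProductProperty A B C) :
    TripleProductProperty (S₀ * A) (T₀ * B) (U₀ * C) := by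
  intro x hx x' hx' y hy y' hy' w hw w' hw' heq
  obtain ⟨s, hs, a, ha, rfl⟩ := Finset.mem_mul.1 hx
  obtain ⟨s', hs', a', ha', rfl⟩ := Finset.mem_mul.1 hx'
  obtain ⟨t, ht, b, hb, rfl⟩ := Finset.mem_mul.1 hy
  obtain ⟨t', ht', b', hb', rfl⟩ := Finset.mem_mul.1 hy'
  obtain ⟨u, hu, c, hc, rfl⟩ := Finset.mem_mul.1 hw
  obtain ⟨u', hu', c', hc', rfl⟩ := Finset.mem_mul.1 hw'
  set α := a * a'⁻¹ with hα
  set β := b * b'⁻¹ with hβ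
  set γ := c * c'⁻¹ with hγ
  have hαZ : α ∈ Z := Z.mul_mem (hA a ha) (Z.inv_mem (hA a' ha'))
  have hβZ : β ∈ Z := Z.mul_mem (hB b hb) (Z.inv_mem (hB b' hb'))
  have hγZ : γ ∈ Z := Z.mul_mem (hC c hc) (Z.inv_mem (hC c' hc'))
  -- conjugated set elements
  set S₁ := (α * β * γ)⁻¹ * s * (α * β * γ) with hS₁
  set S₂ := (β * γ)⁻¹ * s' * (β * γ) with hS₂
  set T₁ := (β * γ)⁻¹ * t * (β * γ) with hT₁
  set T₂ := γ⁻¹ * t' * γ with hT₂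
  set U₁ := γ⁻¹ * u * γ with hU₁
  have hS₁m : S₁ ∈ S₀ := hS.conj_mem (Z.mul_mem (Z.mul_mem hαZ hβZ) hγZ) hs
  have hS₂m : S₂ ∈ S₀ := hS.conj_mem (Z.mul_mem hβZ hγZ) hs'
  have hT₁m : T₁ ∈ T₀ := hT.conj_mem (Z.mul_mem hβZ hγZ) ht
  have hT₂m : T₂ ∈ T₀ := hT.conj_mem hγZ ht'
  have hU₁m : U₁ ∈ U₀ := hU.conj_mem hγZ hu
  -- the key identity
  have key : s * a * (s' * a')⁻¹ * (t * b * (t' * b')⁻¹) * (u * c * (u' * c')⁻¹)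
      = (α * β * γ) * (S₁ * S₂⁻¹ * (T₁ * T₂⁻¹) * (U₁ * u'⁻¹)) := by
    simp only [hS₁, hS₂, hT₁, hT₂, hU₁, hα, hβ, hγ]
    group
  rw [key] at heq
  have hin : S₁ * S₂⁻¹ * (T₁ * T₂⁻¹) * (U₁ * u'⁻¹) ∈ Z := by
    have : S₁ * S₂⁻¹ * (T₁ * T₂⁻¹) * (U₁ * u'⁻¹) = (α * β * γ)⁻¹ :=
      eq_inv_of_mul_eq_one_right heq
    rw [this]
    exact Z.inv_mem (Z.mul_mem (Z.mul_mem hαZ hβZ) hγZ)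
  obtain ⟨h1, h2, h3⟩ := hZ S₁ hS₁m S₂ hS₂m T₁ hT₁m T₂ hT₂m U₁ hU₁m u' hu' hin
  have habc : α * β * γ = 1 := by
    have h0 : S₁ * S₂⁻¹ * (T₁ * T₂⁻¹) * (U₁ * u'⁻¹) = 1 := by rw [h1, h2, h3]; group
    rw [h0, mul_one] at heq
    exact heq
  obtain ⟨ha1, hb1, hc1⟩ := hABC a ha a' ha' b hb b' hb' c hc c' hc' (by simpa [hα, hβ, hγ] using habc)
  subst ha1; subst hb1; subst hc1
  have hα1 : α = 1 := by simp [hα]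
  have hβ1 : β = 1 := by simp [hβ]
  have hγ1 : γ = 1 := by simp [hγ]
  have e1 : s = s' := by
    have := h1; simp only [hS₁, hS₂, hα1, hβ1, hγ1] at this; simpa using this
  have e2 : t = t' := by
    have := h2; simp only [hT₁, hT₂, hβ1, hγ1] at this; simpa using this
  have e3 : u = u' := by
    have := h3; simp only [hU₁, hγ1] at this; simpa using this
  exact ⟨by rw [e1], by rw [e2], by rw [e3]⟩

/-! ## §2 The recursion form for `S_n` (statements) -/

/-- RELATIVE THRESHOLD DESIGNS: cofinally in `n`, a subgroup `Z ≤ S_n`, a `Z`-normalised triple that is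
TPP modulo `Z`, and a TPP triple inside `Z`, whose composed volume beats `(n!)^{3/2}e^{-c√n}`.
With `Z = ⊥`, `A = B = C = {1}` this is `ThresholdSubsetTriples` verbatim, so it is a FRAMEWORK
(reformulation with a free parameter `Z`), not a strengthening; its content is the recursion
`ρ_n ≥ ρ(Z)·η(relative design)`. -/
def RelativeThreshold : Prop :=
  ∀ c : ℝ, 0 < c → ∀ n₀ : ℕ, ∃ n ≥ n₀, ∃ Z : Subgroup (Equiv.Perm (Fin n)),
    ∃ S₀ T₀ U₀ A B C : Finset (Equiv.Perm (Fin n)),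
      Normalises Z S₀ ∧ Normalises Z T₀ ∧ Normalises Z U₀ ∧ ZTPP Z S₀ T₀ U₀ ∧
      (∀ a ∈ A, a ∈ Z) ∧ (∀ b ∈ B, b ∈ Z) ∧ (∀ c ∈ C, c ∈ Z) ∧ TripleProductProperty A B C ∧
      (n.factorial : ℝ) ^ ((3 : ℝ) / 2) * Real.exp (-(c * Real.sqrt (n : ℝ))) <
        (((S₀ * A).card * (T₀ * B).card * (U₀ * C).card : ℕ) : ℝ)

theorem thresholdSubsetTriples_of_relative (h : RelativeThreshold) :
    Summit.MatrixMultiplication.MatrixMultiplication.Theses.SnSubsetDichotomy.ThresholdSubsetTriples := by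
  intro c hc n₀
  obtain ⟨n, hn, Z, S₀, T₀, U₀, A, B, C, hS, hT, hU, hZ, hA, hB, hC, hABC, hvol⟩ := h c hc n₀
  exact ⟨n, hn, S₀ * A, T₀ * B, U₀ * C,
    tpp_of_normalised_relative Z S₀ T₀ U₀ A B C hS hT hU hZ hA hB hC hABC, hvol⟩

/-! ## §3 Generalised Wedderburn sieve (statement for the negative side; proof = SubgroupPivotSieve with `1_S`) -/

/-- PLANCHEREL-FAT MEMBERS (necessary condition; to be landed by a refuter): for a rooted TPP triple in a
finite group, `|T|·|U| ≤ Σ_{λ : Ŝ(λ) ≠ 0} (dim λ)²` — the two-sided ideal generated by `1_S` contains the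
`|T||U|` linearly independent vectors `δ_{t⁻¹} * 1_S * δ_{u'}`.  Stated here over `MonoidAlgebra ℂ G`
with the ideal's dimension as a `Module.finrank`. -/
def PlancherelFat : Prop :=
  ∀ (G : Type) [Group G] [Fintype G] [DecidableEq G] (S T U : Finset G),
    (1 : G) ∈ S → TripleProductProperty S T U →
      T.card * U.card ≤ Module.finrank ℂ
        (Submodule.span ℂ (Set.range fun p : G × G =>
          MonoidAlgebra.single p.1 (1 : ℂ) * (∑ h ∈ S, MonoidAlgebra.single h (1 : ℂ)) *
            MonoidAlgebra.single p.2 1))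


/-! ## §4 The Riemann–Hurwitz (genus) certificate — card `riemann-hurwitz-short-triples` -/

section Genus
variable {n : ℕ}

/-- Number of cycles of `σ` on `Fin n`, fixed points included (= number of `⟨σ⟩`-orbits). -/
noncomputable def cycNum (σ : Equiv.Perm (Fin n)) : ℕ :=
  Nat.card (MulAction.orbitRel.Quotient (Subgroup.zpowers σ) (Fin n))

/-- Number of orbits of the subgroup generated by `σ` and `τ` on `Fin n`. -/
noncomputable def orbNum (σ τ : Equiv.Perm (Fin n)) : ℕ :=
  Nat.card (MulAction.orbitRel.Quotient (Subgroup.closure ({σ, τ} : Set (Equiv.Perm (Fin n)))) (Fin n))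

/-- RIEMANN–HURWITZ FOR 3-CONSTELLATIONS (classical; Jacques 1968, Lando–Zvonkin Ch. 1): if
`σ₁ σ₂ σ₃ = 1` in `S_n` then `cyc σ₁ + cyc σ₂ + cyc σ₃ ≤ n + 2·orb⟨σ₁,σ₂⟩` (Euler characteristic
`≤ 2` on each orbit).  The FIRST LEMMA of the line: a genuine theorem to be proved in the tree
(induction on a transposition factorisation, or the hypermap Euler formula). -/
def RiemannHurwitzIneq : Prop :=
  ∀ n : ℕ, ∀ σ₁ σ₂ σ₃ : Equiv.Perm (Fin n), σ₁ * σ₂ * σ₃ = 1 →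
    cycNum σ₁ + cycNum σ₂ + cycNum σ₃ ≤ n + 2 * orbNum σ₁ σ₂

/-- GENUS-CERTIFIED triples: pairwise the quotient sets meet only in `1`, and every triple of
NON-TRIVIAL quotients is "too short to close up": `cyc q₁ + cyc q₂ + cyc q₃ > n + 2·orb⟨q₁,q₂⟩`. -/
def GenusCertified (S T U : Finset (Equiv.Perm (Fin n))) : Prop :=
  (∀ s ∈ S, ∀ s' ∈ S, ∀ t ∈ T, ∀ t' ∈ T, s * s'⁻¹ = t * t'⁻¹ → s = s' ∧ t = t') ∧
  (∀ t ∈ T, ∀ t' ∈ T, ∀ u ∈ U, ∀ u' ∈ U, t * t'⁻¹ = u * u'⁻¹ → t = t' ∧ u = u') ∧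
  (∀ u ∈ U, ∀ u' ∈ U, ∀ s ∈ S, ∀ s' ∈ S, u * u'⁻¹ = s * s'⁻¹ → u = u' ∧ s = s') ∧
  (∀ s ∈ S, ∀ s' ∈ S, ∀ t ∈ T, ∀ t' ∈ T, ∀ u ∈ U, ∀ u' ∈ U, s ≠ s' → t ≠ t' → u ≠ u' →
    n + 2 * orbNum (s * s'⁻¹) (t * t'⁻¹) < cycNum (s * s'⁻¹) + cycNum (t * t'⁻¹) + cycNum (u * u'⁻¹))

/-- The certificate is sound: Riemann–Hurwitz + genus-certified ⇒ TPP.  (Case analysis: if all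
three quotients are non-trivial the inequality contradicts Riemann–Hurwitz; if one is trivial the
other two are mutually inverse quotients, excluded pairwise.) -/
theorem tpp_of_genusCertified (hRH : RiemannHurwitzIneq) (S T U : Finset (Equiv.Perm (Fin n)))
    (h : GenusCertified S T U) : TripleProductProperty S T U := by
  obtain ⟨hST, hTU, hUS, h3⟩ := h
  intro s hs s' hs' t ht t' ht' u hu u' hu' heq
  by_cases h1 : s = s'
  · subst h1
    have htu : t * t'⁻¹ = (u * u'⁻¹)⁻¹ := by
      rw [eq_inv_iff_mul_eq_one]; simpa using heq
    have htu' : t * t'⁻¹ = u' * u⁻¹ := by rw [htu]; group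
    obtain ⟨e1, e2⟩ := hTU t ht t' ht' u' hu' u hu htu'
    exact ⟨rfl, e1, e2.symm⟩
  by_cases h2 : t = t'
  · subst h2
    have hsu : s * s'⁻¹ = (u * u'⁻¹)⁻¹ := by
      rw [eq_inv_iff_mul_eq_one]; simpa using heq
    have hsu' : u' * u⁻¹ = s * s'⁻¹ := by rw [hsu]; group
    obtain ⟨e1, e2⟩ := hUS u' hu' u hu s hs s' hs' hsu'
    exact ⟨e2, rfl, e1.symm⟩
  by_cases h3' : u = u'
  · subst h3'
    have hst : s * s'⁻¹ = (t * t'⁻¹)⁻¹ := by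
      rw [eq_inv_iff_mul_eq_one]; simpa using heq
    have hst' : s * s'⁻¹ = t' * t⁻¹ := by rw [hst]; group
    obtain ⟨e1, e2⟩ := hST s hs s' hs' t' ht' t ht hst'
    exact ⟨e1, e2.symm, rfl⟩
  exfalso
  have hlt := h3 s hs s' hs' t ht t' ht' u hu u' hu' h1 h2 h3'
  have hle := hRH n (s * s'⁻¹) (t * t'⁻¹) (u * u'⁻¹) heq
  omega

end Genus

end Summit.MatrixMultiplication.MatrixMultiplication.Cruxes.ThresholdSubsetTriples.Ideator6
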